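import Summits.QuantumFields.YangMills.Theorems.InfiniteVolumeContinuumIVEuclideanInvarianceSigned
import HarnessLib

/-!
# The exact reflection law of the single-plane fields under the transported link reflections, all axes
# (helper for support `ChessboardTransfer`, stmt-QuantumFields-23370, route `DyadicChessboard`)

Second helper toward the Wilson instance of the chessboard estimate (companion of
`Theorems/DyadicChessboardWilsonChessboardRP.lean`): the COHERENCE input.  For the transported link reflection of
axis `i` through the bond hyperplane `x_i = w_i + ½` (and its antipode),
`Θ_{i,w} = τ_{w} ∘ (swap 0 i)_* ∘ Θ₀ ∘ (swap 0 i)_*⁻¹ ∘ τ_{−w}` on the torus `(ℤ/L)^4` (`w : ℤ⁴`, shift by `proj w`),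
the single-plane field read through the periodic lift obeys

  `plane q y (lift (Θ_{i,w} U)) = plane q (y[i ↦ 2 w_i + 1 − y_i − [i ∈ q]]) (lift U)`      (`plane_torusLift_theta_swap`),

i.e. magnetic plaquettes (`i ∉ q`) are carried to the mirror base point and electric ones (`i ∈ q`) hang one unit
lower — exactly the parity-reflected in-cell position `N − 1 − p_k − [k ∈ q]` of `DyadicArrayCeiling`'s `site`
formula.  General form for any axis permutation `π` and shift `w`: `plane_torusLift_theta`.  Assembled from the tree's
`plane_torusLift_timeReflect` (time axis), `plane_configPermZd`, `configPermZd_torusLift`, the lift/translation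
intertwining and `plane_configShift`.  Cell `ym-idea-1` width seat `ym-line-sfw-p2-w3` g29 (free hands).
HONEST FRAMING: helper only; no crux, rung or summit is proved; the YM mass gap is NOT proved. [folklore]
-/

set_option autoImplicit false

noncomputable section

namespace Summit.QuantumFields.YangMills.Theorems.DyadicChessboard.PlaneReflection

open MeasureTheory
open Literature.MathematicalPhysics.QuantumFieldTheory Literature.MathematicalPhysics.QuantumLattice
open Literature.Probability.LatticeModels (Site Torus.proj)
open Summit.QuantumFields.YangMills.Theorems.OSLegsFromFemtoAndGap (permPlane permPlane_valid permPlane_symm_permPlane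
  thetaSite plane_torusLift_timeReflect)
open Summit.QuantumFields.YangMills.Theorems.InfiniteVolume (plane_configPermZd)
open Summit.QuantumFields.YangMills.Cruxes.OSLegsFromFemtoAndGap.DlrCollarTransfer (plane)

variable {G : Type} [Group G] [TopologicalSpace G] [IsTopologicalGroup G] [CompactSpace G]
  [MeasurableSpace G] [BorelSpace G] (r : LatticeRep G)

omit [TopologicalSpace G] [IsTopologicalGroup G] [CompactSpace G] [BorelSpace G] [Group G] in
/-- The periodic lift intertwines the torus translation by `proj w` with the `ℤ⁴` translation by `w`. [folklore] -/
theorem torusLift_torusConfigShift_proj' (L : ℕ) (w : Site 4) (U : GaugeConfig 4 L G) :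
    torusLift L (torusConfigShift (Torus.proj L w) U) = configShift w (torusLift L U) :=
  (congrFun (toTorusObservable_comp_configShift (G := G) L w (id : LGConfig 4 G → LGConfig 4 G)) U).symm

omit [TopologicalSpace G] [IsTopologicalGroup G] [CompactSpace G] [BorelSpace G] [Group G] [MeasurableSpace G] in
/-- `proj (−w) = −proj w`. [folklore] -/
private theorem proj_neg (L : ℕ) (w : Site 4) : Torus.proj L (-w) = -Torus.proj L w := by
  funext k; simp [Literature.Probability.LatticeModels.Torus.proj_apply]

omit [IsTopologicalGroup G] [CompactSpace G] [BorelSpace G] in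
/-- `plane q y (configShift v U) = plane q (y − v) U`. [folklore] -/
theorem plane_configShift' (v : Site 4) (q : Fin 4 × Fin 4) (y : Site 4) (U : LGConfig 4 G) :
    plane G r q y (configShift v U) = plane G r q (y - v) U := by
  unfold plane
  congr 1
  funext e
  simp only [configShift_apply, neg_sub', sub_neg_eq_add]
  congr 2
  abel

omit [BorelSpace G] in
/-- **Reflection law of the plane fields under a transported link reflection** (general axis permutation `π` and
integer shift `w`): `plane q y (lift (τ_{proj w} π_* Θ₀ π_*⁻¹ τ_{−proj w} U))
= plane q (sitePermZd π (θ̃_{q'} (sitePermZd π⁻¹ (y − w))) + w) (lift U)` with `q' = permPlane π⁻¹ q` and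
`θ̃` the tree's `thetaSite` (`thetaSite q' x = x[0 ↦ 1 − x₀] − [q'.1 = 0] e₀`). [folklore] -/
theorem plane_torusLift_theta (L : ℕ) (π : Equiv.Perm (Fin 4)) (w : Site 4) {q : Fin 4 × Fin 4} (hq : q.1 < q.2)
    (y : Site 4) (U : GaugeConfig 4 L G) :
    plane G r q y (torusLift L (torusConfigShift (Torus.proj L w) (configPerm π (GaugeConfig.timeReflect
      (configPerm π.symm (torusConfigShift (-Torus.proj L w) U)))))) =
      plane G r q (sitePermZd π (thetaSite (permPlane π.symm q) (sitePermZd π.symm (y - w))) + w) (torusLift L U) := by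
  have hq' : (permPlane π.symm q).1 < (permPlane π.symm q).2 := permPlane_valid π.symm hq
  -- peel the outer translation and axis permutation
  rw [torusLift_torusConfigShift_proj', plane_configShift',
    ← Literature.MathematicalPhysics.QuantumFieldTheory.configPermZd_torusLift, plane_configPermZd,
    plane_torusLift_timeReflect r L hq',
    ← Literature.MathematicalPhysics.QuantumFieldTheory.configPermZd_torusLift, plane_configPermZd, Equiv.symm_symm,
    permPlane_symm_permPlane_symm' π hq, ← proj_neg, torusLift_torusConfigShift_proj', plane_configShift', sub_neg_eq_add]
where
  /-- `permPlane π` undoes `permPlane π⁻¹` on valid planes (the tree lemma with `π⁻¹` for `π`). [folklore] -/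
  permPlane_symm_permPlane_symm' (π : Equiv.Perm (Fin 4)) {q : Fin 4 × Fin 4} (hq : q.1 < q.2) :
      permPlane π (permPlane π.symm q) = q := by
    simpa using permPlane_symm_permPlane π.symm hq

/-- The first direction of the re-sorted plane `permPlane (swap 0 i) q` is the time axis iff `i ∈ q`. [folklore] -/
theorem permPlane_swap_fst_eq_zero_iff (i : Fin 4) {q : Fin 4 × Fin 4} (hq : q.1 < q.2) :
    (permPlane (Equiv.swap 0 i) q).1 = 0 ↔ (q.1 = i ∨ q.2 = i) := by
  have hne : q.1 ≠ q.2 := ne_of_lt hq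
  have h1 : (Equiv.swap (0 : Fin 4) i) q.1 = 0 ↔ q.1 = i := by
    rw [Equiv.swap_apply_eq_iff, Equiv.swap_apply_left]
  have h2 : (Equiv.swap (0 : Fin 4) i) q.2 = 0 ↔ q.2 = i := by
    rw [Equiv.swap_apply_eq_iff, Equiv.swap_apply_left]
  unfold permPlane
  split_ifs with h
  · simp only
    constructor
    · intro h0; exact Or.inl (h1.1 h0)
    · rintro (ha | hb)
      · exact h1.2 ha
      · exfalso
        have hb0 := h2.2 hb
        rw [hb0] at h
        exact (Fin.not_lt_zero _) h
  · simp only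
    constructor
    · intro h0; exact Or.inr (h2.1 h0)
    · rintro (ha | hb)
      · exfalso
        have ha0 := h1.2 ha
        rw [ha0] at h
        exact h (lt_of_le_of_ne (Fin.zero_le _) (fun h00 => hne (by
          have := (Equiv.swap (0 : Fin 4) i).injective (ha0.trans h00)
          exact this)))
      · exact h2.2 hb

omit [BorelSpace G] in
/-- **Reflection law of the plane fields under the link reflection of axis `i` through the bond hyperplane
`x_i = w_i + ½`** (`Θ_{i,w} = τ_{proj w} ∘ (swap 0 i)_* ∘ Θ₀ ∘ (swap 0 i)_* ∘ τ_{−proj w}`):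
`plane q y (lift (Θ_{i,w} U)) = plane q (y[i ↦ 2 w_i + 1 − y_i − [i ∈ q]]) (lift U)` — the mirror base point, one
unit lower for the plaquettes containing the axis `i` (K1's parity-reflected in-cell position). [folklore] -/
theorem plane_torusLift_theta_swap (L : ℕ) (i : Fin 4) (w : Site 4) {q : Fin 4 × Fin 4} (hq : q.1 < q.2)
    (y : Site 4) (U : GaugeConfig 4 L G) :
    plane G r q y (torusLift L (torusConfigShift (Torus.proj L w) (configPerm (Equiv.swap 0 i)
      (GaugeConfig.timeReflect (configPerm (Equiv.swap 0 i).symm (torusConfigShift (-Torus.proj L w) U)))))) =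
      plane G r q (Function.update y i (2 * w i + 1 - y i - if q.1 = i ∨ q.2 = i then 1 else 0))
        (torusLift L U) := by
  rw [plane_torusLift_theta r L (Equiv.swap 0 i) w hq y U, Equiv.symm_swap]
  congr 1
  funext j
  simp only [Pi.add_apply, sitePermZd_apply, Equiv.symm_swap, thetaSite, Pi.sub_apply,
    Summit.QuantumFields.YangMills.Theorems.HypercubicLimit.Negative.thetaZ]
  by_cases hj : j = i
  · subst hj
    rw [Equiv.swap_apply_right, Function.update_self, Function.update_self]
    by_cases hq0 : q.1 = j ∨ q.2 = j
    · rw [if_pos ((permPlane_swap_fst_eq_zero_iff j hq).2 hq0), if_pos hq0]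
      simp only [Pi.single_apply, if_true, Equiv.swap_apply_left]
      ring
    · rw [if_neg (fun h => hq0 ((permPlane_swap_fst_eq_zero_iff j hq).1 h)), if_neg hq0]
      simp only [Pi.zero_apply, Equiv.swap_apply_left]
      ring
  · have hπj : (Equiv.swap (0 : Fin 4) i) j ≠ 0 := by
      intro h
      have : j = (Equiv.swap (0 : Fin 4) i).symm 0 := ((Equiv.symm_apply_eq _).2 h.symm).symm
      rw [Equiv.symm_swap, Equiv.swap_apply_left] at this
      exact hj this
    rw [Function.update_of_ne hj, Function.update_of_ne hπj]
    have hsingle : (if (permPlane (Equiv.swap 0 i) q).1 = 0 then (Pi.single 0 1 : Site 4) else 0)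
        ((Equiv.swap (0 : Fin 4) i) j) = 0 := by
      split_ifs
      · rw [Pi.single_apply, if_neg hπj]
      · rfl
    rw [hsingle, sub_zero, sitePermZd_apply, Equiv.symm_swap, Equiv.swap_apply_self, Pi.sub_apply]
    ring


end Summit.QuantumFields.YangMills.Theorems.DyadicChessboard.PlaneReflection

end
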